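import Literature.RingTheory.HilbertSamuel.NormalFlatnessHilbertFunction
import Mathlib.LinearAlgebra.Dimension.OrzechProperty
import Mathlib.RingTheory.OrzechProperty
import Mathlib.LinearAlgebra.Dimension.Free
import Mathlib.LinearAlgebra.Dimension.Constructions
import HarnessLib

/-!
# Generator counts for the graded pieces `𝔭ⁱ/𝔭ⁱ⁺¹`: `μ(𝔭ⁱ)`, `rk_{R/𝔭}(𝔭ⁱ/𝔭ⁱ⁺¹)` and `H^{(0)}[R_𝔭](i)`

Topic: `Literature/RingTheory/HilbertSamuel`. Infrastructure for Bennett's numerical criterion of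
normal flatness (Herrmann–Ikeda–Orbanz, *Equimultiplicity and Blowing up*, Thm. (22.24); CJS 2020,
Thm. 3.3), continuing `NormalFlatnessHilbertFunction.lean` (`spanFinrank_pow_le_hilbertFun_of_free`:
if `𝔭ⁱ/𝔭ⁱ⁺¹` is free over `R/𝔭` then `μ(𝔭ⁱ) ≤ H^{(0)}[R_𝔭](i)`). For a Noetherian local ring
`(R, 𝔪, k)`, a prime `𝔭` and a localization `R_𝔭`, with `μ = ` minimal number of generators
(`Submodule.spanFinrank`), this file PROVES:

* `spanFinrank_le_finrank_of_surjective` — Nakayama count: if an `R`-linear surjection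
  `ψ : I → P` onto a finite free `B`-module (`R → B` surjective) has `ker ψ ⊆ 𝔪I`, then
  `μ(I) ≤ rk_B P` (lift a basis);
* `hilbertFun_le_spanFinrank_pow` — `H^{(0)}[R_𝔭](i) ≤ μ(𝔭ⁱ)` (the images of generators of `𝔭ⁱ`
  span `𝔪_{R_𝔭}ⁱ/𝔪_{R_𝔭}ⁱ⁺¹` over `k(𝔭)`);
* `finrank_gradedPiece_le_spanFinrank_pow` — `rk_{R/I}(Iⁱ/Iⁱ⁺¹) ≤ μ(Iⁱ)`;
* `finrank_gradedPiece_eq_hilbertFun_of_free` — if `𝔭ⁱ/𝔭ⁱ⁺¹` is FREE over `R/𝔭` then its rank is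
  `H^{(0)}[R_𝔭](i)` (and equals `μ(𝔭ⁱ)`);
* `free_gradedPiece_of_spanFinrank_le` — conversely, **if `μ(𝔭ⁱ) ≤ H^{(0)}[R_𝔭](i)` then
  `𝔭ⁱ/𝔭ⁱ⁺¹` is free over `R/𝔭`**: a minimal system of generators of `𝔭ⁱ` has classes spanning
  `𝔭ⁱ/𝔭ⁱ⁺¹`, and their images in the `k(𝔭)`-space `𝔭ⁱR_𝔭/𝔭ⁱ⁺¹R_𝔭` of dimension `≥ μ(𝔭ⁱ)` span,
  hence are linearly independent (`linearIndependent_of_top_le_span_of_card_le_finrank`), which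
  pulls back to linear independence over the domain `R/𝔭` (this is the freeness criterion
  "`μ = ` generic rank" for modules over a local domain, made explicit for graded pieces; cf.
  Singh, Compositio Math. 33 (1976), Cor. (1.4): `𝔭` permissible iff `μ(𝔭ⁿ) = μ(𝔭ⁿ𝒪_𝔭)` for
  all `n`, given `𝒪/𝔭` regular).

No definitions and no named facts are introduced.

## Sources

* M. Herrmann, S. Ikeda, U. Orbanz, *Equimultiplicity and Blowing up*, Springer 1988, Ch. IV,
  §21–§22 (context: Cor. (21.12), Thm. (22.24)). [HerrmannIkedaOrbanz1988]
* B. Singh, *A numerical criterion for the permissibility of a blowing-up*, Compositio Math. 33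
  (1976), 15–28, §1 ((1.1): `μ(𝔭ⁿ) = H^{(0)}_𝔭(n)`; Cor. (1.4): for `𝒪/𝔭` regular, `𝔭` is
  permissible iff `μ(𝔭ⁿ) = μ(𝔭ⁿ𝒪_𝔭)` for all `n`). The degree-wise statements here are the
  linear algebra behind it, for an arbitrary prime. [Singh1976]
* H. Matsumura, *Commutative Ring Theory*, CUP 1986, Thm. 2.3 (Nakayama). [Matsumura1987]
* V. Cossart, U. Jannsen, S. Saito, LNM 2270 (2020), Thm. 3.3. [CossartJannsenSaito2020]
-/

noncomputable section

open IsLocalRing Finset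

namespace Literature.RingTheory.HilbertSamuel

universe u v w

variable {R : Type u} [CommRing R] [IsLocalRing R] [IsNoetherianRing R]

/-! ## A Nakayama count -/

/-- **Nakayama count.** Let `(R, 𝔪)` be Noetherian local, `R → B` a surjective ring map, `P` a
finite free `B`-module and `ψ : I → P` an `R`-linear surjection from an ideal `I` with
`ker ψ ⊆ 𝔪I`. Then `μ(I) ≤ rk_B(P)`: lifts `g₁, …, g_n ∈ I` of a `B`-basis of `P` satisfy
`I = (g₁, …, g_n) + 𝔪I`, hence generate `I` by Nakayama's lemma (Matsumura Thm. 2.3).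
[cite: Matsumura1987, Thm. 2.3 (Nakayama; consequence made explicit)] -/
theorem spanFinrank_le_finrank_of_surjective {B : Type v} [CommRing B] [Nontrivial B]
    [Algebra R B] (hB : Function.Surjective (algebraMap R B)) {P : Type w} [AddCommGroup P]
    [Module B P] [Module R P] [IsScalarTower R B P] [Module.Free B P] [Module.Finite B P]
    (I : Ideal R) (ψ : ↥I →ₗ[R] P) (hψ : Function.Surjective ψ)
    (hker : ∀ c : ↥I, ψ c = 0 → (c : R) ∈ maximalIdeal R * I) :
    I.spanFinrank ≤ Module.finrank B P := by
  classical
  set n := Module.finrank B P with hn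
  let b : Module.Basis (Fin n) B P := Module.finBasis B P
  choose g hg using fun i => hψ (b i)
  -- `I ⊆ (g_i) + 𝔪 I`
  have hle : I ≤ Ideal.span (Set.range fun i => (g i : R)) ⊔ maximalIdeal R • I := by
    intro y hy
    have hmem : ψ ⟨y, hy⟩ ∈ Submodule.span B (Set.range b) := by
      rw [b.span_eq]; exact Submodule.mem_top
    obtain ⟨c, hc⟩ := (Submodule.mem_span_range_iff_exists_fun B).mp hmem
    choose a ha using fun i => hB (c i)
    have hz : ψ (⟨y, hy⟩ - ∑ i, a i • g i) = 0 := by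
      rw [map_sub, map_sum, sub_eq_zero, ← hc]
      refine Finset.sum_congr rfl fun i _ => ?_
      rw [map_smul, hg i, ← ha i, algebraMap_smul]
    have hzI := hker _ hz
    have hsum : ((∑ i, a i • g i : ↥I) : R) ∈ Ideal.span (Set.range fun i => (g i : R)) := by
      rw [AddSubmonoidClass.coe_finsetSum]
      refine Submodule.sum_mem _ fun i _ => ?_
      rw [SetLike.val_smul, smul_eq_mul]
      exact Ideal.mul_mem_left _ _ (Ideal.subset_span ⟨i, rfl⟩)
    have : y = ((∑ i, a i • g i : ↥I) : R) +
        (((⟨y, hy⟩ : ↥I) - ∑ i, a i • g i : ↥I) : R) := by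
      simp only [AddSubgroupClass.coe_sub]; ring
    rw [this]
    refine Submodule.add_mem_sup hsum ?_
    rw [Ideal.smul_eq_mul]
    exact hzI
  have hspan : I = Ideal.span (Set.range fun i => (g i : R)) := by
    refine le_antisymm ?_ (Ideal.span_le.mpr ?_)
    · exact Submodule.le_of_le_smul_of_le_jacobson_bot (IsNoetherian.noetherian _)
        (IsLocalRing.maximalIdeal_le_jacobson ⊥) hle
    · rintro _ ⟨i, rfl⟩; exact (g i).2
  have hfin : (Set.range fun i => (g i : R)) =
      ((Finset.univ.image fun i => (g i : R)) : Set R) := by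
    rw [Finset.coe_image, Finset.coe_univ, Set.image_univ]
  calc I.spanFinrank ≤ (Set.range fun i => (g i : R)).ncard := by
        conv_lhs => rw [hspan]
        exact Submodule.spanFinrank_span_le_ncard_of_finite (Set.finite_range _)
    _ = (Finset.univ.image fun i => (g i : R)).card := by rw [hfin, Set.ncard_coe_finset]
    _ ≤ Fintype.card (Fin n) := Finset.card_image_le.trans (by rw [Finset.card_univ])
    _ = n := Fintype.card_fin n

/-! ## `H^{(0)}[R_𝔭](i) ≤ μ(𝔭ⁱ)` and `rk(Iⁱ/Iⁱ⁺¹) ≤ μ(Iⁱ)` -/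

section Ranks

variable (p : Ideal R) [p.IsPrime]
variable (Rp : Type v) [CommRing Rp] [Algebra R Rp] [IsLocalization.AtPrime Rp p] [IsLocalRing Rp]

omit [IsLocalRing R] in
/-- **`H^{(0)}[R_𝔭](i) ≤ μ(𝔭ⁱ)`**: `𝔭ⁱR_𝔭 = 𝔪_{R_𝔭}ⁱ` is generated by the images of a minimal
system of generators of `𝔭ⁱ`, whose classes therefore span the `k(𝔭)`-vector space
`𝔪_{R_𝔭}ⁱ/𝔪_{R_𝔭}ⁱ⁺¹` of dimension `H^{(0)}[R_𝔭](i)` (Singh: "`μ(𝔭ⁿ𝒪_𝔭) = H^{(0)}_{𝒪_𝔭}(n)`", so this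
is `μ(𝔭ⁿ𝒪_𝔭) ≤ μ(𝔭ⁿ)`). [cite: Singh1976, §1 (1.1) and Cor. (1.4) (proof)] -/
theorem hilbertFun_le_spanFinrank_pow (i : ℕ) : hilbertFun Rp i ≤ (p ^ i).spanFinrank := by
  classical
  haveI : IsNoetherianRing Rp := IsLocalization.isNoetherianRing p.primeCompl Rp inferInstance
  obtain ⟨G, hGcard, hGspan⟩ := Submodule.FG.exists_span_finset_card_eq_spanFinrank
    (IsNoetherian.noetherian (p ^ i))
  have hmap : (p ^ i).map (algebraMap R Rp) = maximalIdeal Rp ^ i := by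
    rw [Ideal.map_pow, IsLocalization.AtPrime.map_eq_maximalIdeal p Rp]
  have hGmem : ∀ g ∈ (G : Set R), g ∈ p ^ i := fun g hg => by
    rw [← hGspan]; exact Submodule.subset_span hg
  have hgmem : ∀ g : ↥(G : Set R), algebraMap R Rp g ∈ maximalIdeal Rp ^ i := fun g => by
    rw [← hmap]; exact Ideal.mem_map_of_mem _ (hGmem g g.2)
  -- `𝔪_{R_𝔭}ⁱ` is the span of the images of the generators
  have hRp : maximalIdeal Rp ^ i = Ideal.span (Set.range fun g : ↥(G : Set R) => algebraMap R Rp g) := by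
    rw [← hmap, ← hGspan, Ideal.map_span, Set.image_eq_range]
  have hJ : Ideal.span (Set.range fun g : ↥(G : Set R) => algebraMap R Rp g) ≤ maximalIdeal Rp ^ i :=
    hRp.symm.le
  let c : ↥(G : Set R) → gradedPiece (maximalIdeal Rp) i :=
    fun g => gradedPiece.mk _ i ⟨algebraMap R Rp g, hgmem g⟩
  have hspan : ∀ a (ha : a ∈ Ideal.span (Set.range fun g : ↥(G : Set R) => algebraMap R Rp g)),
      gradedPiece.mk (maximalIdeal Rp) i ⟨a, hJ ha⟩ ∈ Submodule.span Rp (Set.range c) := by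
    intro a ha
    induction ha using Submodule.span_induction with
    | mem x hx =>
      obtain ⟨g, rfl⟩ := hx
      exact Submodule.subset_span ⟨g, rfl⟩
    | zero =>
      have : (⟨0, hJ (zero_mem _)⟩ : ↥(maximalIdeal Rp ^ i)) = 0 := rfl
      rw [this, map_zero]; exact zero_mem _
    | add x y hx hy ihx ihy =>
      have : (⟨x + y, hJ (add_mem hx hy)⟩ : ↥(maximalIdeal Rp ^ i)) =
          ⟨x, hJ hx⟩ + ⟨y, hJ hy⟩ := rfl
      rw [this, map_add]; exact add_mem ihx ihy
    | smul r x hx ihx =>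
      have : (⟨r • x, hJ (Submodule.smul_mem _ r hx)⟩ : ↥(maximalIdeal Rp ^ i)) =
          r • ⟨x, hJ hx⟩ := rfl
      rw [this, map_smul]; exact Submodule.smul_mem _ r ihx
  have htop : Submodule.span Rp (Set.range c) = ⊤ := by
    rw [eq_top_iff]
    rintro z -
    obtain ⟨⟨y, hy⟩, rfl⟩ := gradedPiece.mk_surjective _ i z
    have hy' : y ∈ Ideal.span (Set.range fun g : ↥(G : Set R) => algebraMap R Rp g) := hRp ▸ hy
    exact hspan y hy'
  have hk : Function.Surjective (algebraMap Rp (ResidueField Rp)) := Ideal.Quotient.mk_surjective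
  have htop' : Submodule.span (ResidueField Rp) (Set.range c) = ⊤ := by
    rw [← Submodule.restrictScalars_eq_top_iff Rp,
      Submodule.restrictScalars_span Rp (ResidueField Rp) hk, htop]
  have hfin := finrank_range_le_card (R := ResidueField Rp) c
  rw [Set.finrank, htop', finrank_top] at hfin
  calc hilbertFun Rp i ≤ Fintype.card ↥(G : Set R) := hfin
    _ = G.card := by simp
    _ = _ := hGcard

omit [IsLocalRing R] in
/-- **`rk_{R/I}(Iⁱ/Iⁱ⁺¹) ≤ μ(Iⁱ)`**: the classes of a minimal system of generators of `Iⁱ` span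
`Iⁱ/Iⁱ⁺¹` over `R/I` (private helper). [folklore] -/
private theorem finrank_gradedPiece_le_spanFinrank_pow (I : Ideal R) (hI : I ≠ ⊤) (i : ℕ) :
    Module.finrank (R ⧸ I) (gradedPiece I i) ≤ (I ^ i).spanFinrank := by
  classical
  haveI : Nontrivial (R ⧸ I) := Ideal.Quotient.nontrivial_iff.mpr hI
  obtain ⟨G, hGcard, hGspan⟩ := Submodule.FG.exists_span_finset_card_eq_spanFinrank
    (IsNoetherian.noetherian (I ^ i))
  have hGmem : ∀ g ∈ (G : Set R), g ∈ I ^ i := fun g hg => by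
    rw [← hGspan]; exact Submodule.subset_span hg
  let c : ↥(G : Set R) → gradedPiece I i := fun g => gradedPiece.mk I i ⟨g, hGmem g g.2⟩
  have htopR : Submodule.span R (Set.range c) = ⊤ := by
    rw [eq_top_iff]
    rintro z -
    obtain ⟨⟨y, hy⟩, rfl⟩ := gradedPiece.mk_surjective I i z
    have hy' : y ∈ Submodule.span R (Set.range fun g : ↥(G : Set R) => (g : R)) := by
      rw [Subtype.range_coe, hGspan]; exact hy
    obtain ⟨a, ha⟩ := (Submodule.mem_span_range_iff_exists_fun R).mp hy'
    have hsum : (⟨y, hy⟩ : ↥(I ^ i)) = ∑ j, a j • (⟨(j : R), hGmem j j.2⟩ : ↥(I ^ i)) := by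
      apply Subtype.ext
      rw [AddSubmonoidClass.coe_finsetSum]
      simp only [SetLike.val_smul, smul_eq_mul]
      rw [← ha]
      simp only [smul_eq_mul]
    rw [hsum, map_sum]
    refine Submodule.sum_mem _ fun j _ => ?_
    rw [map_smul]
    exact Submodule.smul_mem _ _ (Submodule.subset_span ⟨j, rfl⟩)
  have hk : Function.Surjective (algebraMap R (R ⧸ I)) := Ideal.Quotient.mk_surjective
  have htop : Submodule.span (R ⧸ I) (Set.range c) = ⊤ := by
    rw [← Submodule.restrictScalars_eq_top_iff R, Submodule.restrictScalars_span R (R ⧸ I) hk,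
      htopR]
  have hfin := finrank_range_le_card (R := R ⧸ I) c
  rw [Set.finrank, htop, finrank_top] at hfin
  calc Module.finrank (R ⧸ I) (gradedPiece I i) ≤ Fintype.card ↥(G : Set R) := hfin
    _ = G.card := by simp
    _ = _ := hGcard

/-- **If `𝔭ⁱ/𝔭ⁱ⁺¹` is free over `R/𝔭`, its rank is `H^{(0)}[R_𝔭](i)`** (which is then also
`μ(𝔭ⁱ)`): `rk ≤ μ(𝔭ⁱ) ≤ H^{(0)}[R_𝔭](i)` (`spanFinrank_pow_le_hilbertFun_of_free`) and
`H^{(0)}[R_𝔭](i) ≤ μ(𝔭ⁱ) ≤ rk` (Nakayama count for `𝔭ⁱ → 𝔭ⁱ/𝔭ⁱ⁺¹`, kernel `𝔭ⁱ⁺¹ ⊆ 𝔪𝔭ⁱ`).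
This is the equality `μ(𝔭ⁿ) = μ(𝔭ⁿ𝒪_𝔭)` of Singh's Cor. (1.4) in the normally flat case, resp.
the count in HIO's proof of Cor. (21.12).
[cite: Singh1976, Cor. (1.4) (proof)] [cite: HerrmannIkedaOrbanz1988, Cor. (21.12) (proof ingredient)] -/
theorem finrank_gradedPiece_eq_hilbertFun_of_free (i : ℕ) [Module.Free (R ⧸ p) (gradedPiece p i)] :
    Module.finrank (R ⧸ p) (gradedPiece p i) = hilbertFun Rp i := by
  have hp : p ≠ ⊤ := Ideal.IsPrime.ne_top ‹_›
  haveI : Nontrivial (R ⧸ p) := Ideal.Quotient.nontrivial_iff.mpr hp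
  haveI : Module.Finite (R ⧸ p) (gradedPiece p i) := Module.Finite.of_restrictScalars_finite R _ _
  refine le_antisymm ?_ ?_
  · exact (finrank_gradedPiece_le_spanFinrank_pow p hp i).trans
      (spanFinrank_pow_le_hilbertFun_of_free p Rp i)
  · refine (hilbertFun_le_spanFinrank_pow p Rp i).trans ?_
    refine spanFinrank_le_finrank_of_surjective (B := R ⧸ p) Ideal.Quotient.mk_surjective (p ^ i)
      (gradedPiece.mk p i) (gradedPiece.mk_surjective p i) fun c hc => ?_
    rw [gradedPiece.mk_eq_zero_iff, pow_succ'] at hc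
    exact Ideal.mul_mono_left (IsLocalRing.le_maximalIdeal hp) hc

/-- **If `𝔭ⁱ/𝔭ⁱ⁺¹` is free over `R/𝔭` then `μ(𝔭ⁱ) = H^{(0)}[R_𝔭](i)`**: restatement of
`finrank_gradedPiece_eq_hilbertFun_of_free` for the minimal number of generators (Singh,
Cor. (1.4): `𝔭` permissible ⇒ `μ(𝔭ⁿ) = μ(𝔭ⁿ𝒪_𝔭)`, degree-wise). [cite: Singh1976, Cor. (1.4)] -/
theorem spanFinrank_pow_eq_hilbertFun_of_free (i : ℕ) [Module.Free (R ⧸ p) (gradedPiece p i)] :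
    (p ^ i).spanFinrank = hilbertFun Rp i := by
  have hp : p ≠ ⊤ := Ideal.IsPrime.ne_top ‹_›
  refine le_antisymm (spanFinrank_pow_le_hilbertFun_of_free p Rp i) ?_
  rw [← finrank_gradedPiece_eq_hilbertFun_of_free p Rp i]
  exact finrank_gradedPiece_le_spanFinrank_pow p hp i

omit [IsLocalRing R] in
/-- **Freeness from the generator count: if `μ(𝔭ⁱ) ≤ H^{(0)}[R_𝔭](i)` then `𝔭ⁱ/𝔭ⁱ⁺¹` is a free
`R/𝔭`-module.** Let `g₁, …, g_μ` be a minimal system of generators of `𝔭ⁱ`. Their classes span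
`𝔭ⁱ/𝔭ⁱ⁺¹` over `R/𝔭`; their images span the `k(𝔭)`-space `𝔪_{R_𝔭}ⁱ/𝔪_{R_𝔭}ⁱ⁺¹` of dimension
`H^{(0)}[R_𝔭](i) ≥ μ`, so are linearly independent there; and a relation `Σ ā_j [g_j] = 0` over
`R/𝔭`, i.e. `Σ a_j g_j ∈ 𝔭ⁱ⁺¹`, maps to a relation over `k(𝔭)`, forcing `a_j/1 ∈ 𝔪_{R_𝔭}`, i.e.
`a_j ∈ 𝔭`. (The module-theoretic content, degree by degree and for an arbitrary prime, of the
converse direction of Singh's Cor. (1.4): `μ(𝔭ⁿ) = μ(𝔭ⁿ𝒪_𝔭)` for all `n` ⇒ `𝔭` permissible.)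
[cite: Singh1976, Cor. (1.4) (converse direction, degree-wise; proof made explicit)] -/
theorem free_gradedPiece_of_spanFinrank_le (i : ℕ) (h : (p ^ i).spanFinrank ≤ hilbertFun Rp i) :
    Module.Free (R ⧸ p) (gradedPiece p i) := by
  classical
  haveI : IsNoetherianRing Rp := IsLocalization.isNoetherianRing p.primeCompl Rp inferInstance
  obtain ⟨G, hGcard, hGspan⟩ := Submodule.FG.exists_span_finset_card_eq_spanFinrank
    (IsNoetherian.noetherian (p ^ i))
  have hGmem : ∀ g ∈ (G : Set R), g ∈ p ^ i := fun g hg => by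
    rw [← hGspan]; exact Submodule.subset_span hg
  -- the candidate basis of `𝔭ⁱ/𝔭ⁱ⁺¹`
  let b : ↥(G : Set R) → gradedPiece p i := fun g => gradedPiece.mk p i ⟨g, hGmem g g.2⟩
  /- (1) `b` spans -/
  have hbspanR : Submodule.span R (Set.range b) = ⊤ := by
    rw [eq_top_iff]
    rintro z -
    obtain ⟨⟨y, hy⟩, rfl⟩ := gradedPiece.mk_surjective p i z
    have hy' : y ∈ Submodule.span R (Set.range fun g : ↥(G : Set R) => (g : R)) := by
      rw [Subtype.range_coe, hGspan]; exact hy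
    obtain ⟨a, ha⟩ := (Submodule.mem_span_range_iff_exists_fun R).mp hy'
    have hsum : (⟨y, hy⟩ : ↥(p ^ i)) = ∑ j, a j • (⟨(j : R), hGmem j j.2⟩ : ↥(p ^ i)) := by
      apply Subtype.ext
      rw [AddSubmonoidClass.coe_finsetSum]
      simp only [SetLike.val_smul, smul_eq_mul]
      rw [← ha]
      simp only [smul_eq_mul]
    rw [hsum, map_sum]
    refine Submodule.sum_mem _ fun j _ => ?_
    rw [map_smul]
    exact Submodule.smul_mem _ _ (Submodule.subset_span ⟨j, rfl⟩)
  have hk : Function.Surjective (algebraMap R (R ⧸ p)) := Ideal.Quotient.mk_surjective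
  have hbspan : ⊤ ≤ Submodule.span (R ⧸ p) (Set.range b) := by
    rw [top_le_iff, ← Submodule.restrictScalars_eq_top_iff R,
      Submodule.restrictScalars_span R (R ⧸ p) hk, hbspanR]
  /- (2) the images in `𝔪_{R_𝔭}ⁱ/𝔪_{R_𝔭}ⁱ⁺¹` span, hence are linearly independent over `k(𝔭)` -/
  have hmap : ∀ k, (p ^ k).map (algebraMap R Rp) = maximalIdeal Rp ^ k := fun k => by
    rw [Ideal.map_pow, IsLocalization.AtPrime.map_eq_maximalIdeal p Rp]
  have hgmem : ∀ g : ↥(G : Set R), algebraMap R Rp g ∈ maximalIdeal Rp ^ i := fun g => by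
    rw [← hmap i]; exact Ideal.mem_map_of_mem _ (hGmem g g.2)
  have hRp : maximalIdeal Rp ^ i = Ideal.span (Set.range fun g : ↥(G : Set R) => algebraMap R Rp g) := by
    rw [← hmap i, ← hGspan, Ideal.map_span, Set.image_eq_range]
  have hJ : Ideal.span (Set.range fun g : ↥(G : Set R) => algebraMap R Rp g) ≤ maximalIdeal Rp ^ i :=
    hRp.symm.le
  let c : ↥(G : Set R) → gradedPiece (maximalIdeal Rp) i :=
    fun g => gradedPiece.mk _ i ⟨algebraMap R Rp g, hgmem g⟩
  have hspan : ∀ a (ha : a ∈ Ideal.span (Set.range fun g : ↥(G : Set R) => algebraMap R Rp g)),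
      gradedPiece.mk (maximalIdeal Rp) i ⟨a, hJ ha⟩ ∈ Submodule.span Rp (Set.range c) := by
    intro a ha
    induction ha using Submodule.span_induction with
    | mem x hx =>
      obtain ⟨g, rfl⟩ := hx
      exact Submodule.subset_span ⟨g, rfl⟩
    | zero =>
      have : (⟨0, hJ (zero_mem _)⟩ : ↥(maximalIdeal Rp ^ i)) = 0 := rfl
      rw [this, map_zero]; exact zero_mem _
    | add x y hx hy ihx ihy =>
      have : (⟨x + y, hJ (add_mem hx hy)⟩ : ↥(maximalIdeal Rp ^ i)) =
          ⟨x, hJ hx⟩ + ⟨y, hJ hy⟩ := rfl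
      rw [this, map_add]; exact add_mem ihx ihy
    | smul r x hx ihx =>
      have : (⟨r • x, hJ (Submodule.smul_mem _ r hx)⟩ : ↥(maximalIdeal Rp ^ i)) =
          r • ⟨x, hJ hx⟩ := rfl
      rw [this, map_smul]; exact Submodule.smul_mem _ r ihx
  have hctop : Submodule.span Rp (Set.range c) = ⊤ := by
    rw [eq_top_iff]
    rintro z -
    obtain ⟨⟨y, hy⟩, rfl⟩ := gradedPiece.mk_surjective _ i z
    have hy' : y ∈ Ideal.span (Set.range fun g : ↥(G : Set R) => algebraMap R Rp g) := hRp ▸ hy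
    exact hspan y hy'
  have hk' : Function.Surjective (algebraMap Rp (ResidueField Rp)) := Ideal.Quotient.mk_surjective
  have hcspan : ⊤ ≤ Submodule.span (ResidueField Rp) (Set.range c) := by
    rw [top_le_iff, ← Submodule.restrictScalars_eq_top_iff Rp,
      Submodule.restrictScalars_span Rp (ResidueField Rp) hk', hctop]
  have hcard : Fintype.card ↥(G : Set R) ≤
      Module.finrank (ResidueField Rp) (gradedPiece (maximalIdeal Rp) i) := by
    rw [← hilbertFun_def]
    calc Fintype.card ↥(G : Set R) = G.card := by simp
      _ = (p ^ i).spanFinrank := hGcard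
      _ ≤ hilbertFun Rp i := h
  have hcli : LinearIndependent (ResidueField Rp) c :=
    linearIndependent_of_top_le_span_of_card_le_finrank hcspan hcard
  /- (3) `b` is linearly independent over `R/𝔭` -/
  have hbli : LinearIndependent (R ⧸ p) b := by
    rw [Fintype.linearIndependent_iff]
    intro w hw j₀
    choose a ha using fun j => Ideal.Quotient.mk_surjective (w j)
    -- `Σ a_j g_j ∈ 𝔭ⁱ⁺¹`
    have hrel : ∑ j, a j * (j : R) ∈ p ^ (i + 1) := by
      have h0 : gradedPiece.mk p i (∑ j, a j • (⟨(j : R), hGmem j j.2⟩ : ↥(p ^ i))) = 0 := by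
        rw [map_sum, ← hw]
        refine Finset.sum_congr rfl fun j _ => ?_
        rw [map_smul, ← ha j]
        rfl
      rw [gradedPiece.mk_eq_zero_iff, AddSubmonoidClass.coe_finsetSum] at h0
      simpa only [SetLike.val_smul, smul_eq_mul] using h0
    -- in `R_𝔭`: `Σ (a_j/1)‾ • c_j = 0`
    have hzero : ∑ j, (algebraMap Rp (ResidueField Rp) (algebraMap R Rp (a j))) • c j = 0 := by
      have : ∑ j, (algebraMap Rp (ResidueField Rp) (algebraMap R Rp (a j))) • c j =
          gradedPiece.mk (maximalIdeal Rp) i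
            (∑ j, (algebraMap R Rp (a j)) • (⟨algebraMap R Rp (j : R), hgmem j⟩ :
              ↥(maximalIdeal Rp ^ i))) := by
        rw [map_sum]
        refine Finset.sum_congr rfl fun j _ => ?_
        rw [map_smul, algebraMap_smul]
      rw [this, gradedPiece.mk_eq_zero_iff, AddSubmonoidClass.coe_finsetSum]
      simp only [SetLike.val_smul, smul_eq_mul]
      have : ∑ j, algebraMap R Rp (a j) * algebraMap R Rp (j : R) =
          algebraMap R Rp (∑ j, a j * (j : R)) := by
        rw [map_sum]
        simp only [map_mul]
      rw [this, ← hmap (i + 1)]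
      exact Ideal.mem_map_of_mem _ hrel
    have hcoef := (Fintype.linearIndependent_iff.mp hcli) _ hzero j₀
    -- `a_{j₀}/1 ∈ 𝔪_{R_𝔭}`, so `a_{j₀} ∈ 𝔭`
    have hmem : algebraMap R Rp (a j₀) ∈ maximalIdeal Rp := by
      rw [← IsLocalRing.residue_eq_zero_iff]
      exact hcoef
    have hap : a j₀ ∈ p := (IsLocalization.AtPrime.to_map_mem_maximal_iff Rp p (a j₀)).mp hmem
    rw [← ha j₀]
    exact Ideal.Quotient.eq_zero_iff_mem.mpr hap
  exact Module.Free.of_basis (Module.Basis.mk hbli hbspan)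

end Ranks

end Literature.RingTheory.HilbertSamuel

end
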